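import Summits.BirchSwinnertonDyer.Rank1Residual.ManinAdditive.ThetaFourOmegaSign
import Summits.BirchSwinnertonDyer.BirchSwinnertonDyer.Theorems.ManinLocalTwoThreeThetaPairCuspThird
import Literature.NumberTheory.EllipticCurves.RootNumberAtkinLehnerThree
import Mathlib.NumberTheory.LegendreSymbol.QuadraticChar.Basic
import HarnessLib
import HarnessLib.Audit.Tags

/-!
# Twist types at `9 ∥ N` and THE SIGN of `w₉` on theta pairs (cell bsd-f2-manin, desc lens g23, MEMO-desc §48;
SIBLING 5 of `ThetaFourOmega.lean`, same namespace; nothing under `@[conjecture]` is asserted, everything else PROVED)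

«THE SIGN ROW IS A ROOT NUMBER».  At a level `N` with `9 ∥ N` and trivial character the local representation `π₃` of a
newform `f` has conductor exponent `2`, hence is one of exactly three types, told apart E-BLINDLY by the `χ₋₃`-twist:
(a) `χ₋₃μ ⊞ χ₋₃μ⁻¹` (`μ` unramified; Kodaira `I₀*`): `f ⊗ χ₋₃` is new of level `N/9`;      `ε₃ = χ₋₃(−1) = −1`;
(b) `St ⊗ χ₋₃η` (`η` unramified quadratic; Kodaira `Iₙ*`, `n ≥ 1`): `f ⊗ χ₋₃` new of level `N/3`; `ε₃ = −1`;
(c) the UNIQUE supercuspidal of exponent `2`, `Ind_{ℚ₉/ℚ₃} θ₄` (`θ₄` of order `4` on `𝔽₉^×/𝔽₃^×`, `θ₄(3) = −1`; Kodaira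
    III / III*): `f ⊗ χ₋₃` is again a newform of level `N` (LOCALLY twist-stable: `Ind θ₄ ⊗ χ₋₃ ≅ Ind(θ₄·χ₋₃∘N)
    = Ind θ₄^σ ≅ Ind θ₄`; globally `f ⊗ χ₋₃` is a newform of the same level, equal to `f` iff `f` has CM by `ℚ(√−3)` —
    «twist-stable» below never means self-twist); `ε₃ = +1`
    (`τ(θ₄, ψ∘Tr) = −3` on `𝔽₉`, `ε = θ₄(3)·τ/3 = +1`).
The Atkin–Lehner eigenvalue `λ₉(f)` IS `ε₃` [AtkinLi1978, §4; Schmidt 2002, Thm. 3.2.2; KellockDokchitser2023, Rem. 2.2].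
So: `w₉ f = +f` iff `f` is `χ₋₃`-TWIST-STABLE (row E-desc-161), `w₉ f = −f` iff `f` is a twist from level `N/9` or `N/3`.
On the theta side (special order of level `9p` in `B_{3,∞}`, character `θ₄^e` of `O₃^×/(1+𝔓) ≅ 𝔽₉^×`): the `θ₄`-theta
pairs (`e = 1`) live on type (c) (row E-desc-162) and the `θ₄²`-pairs (`e = 2`; `θ₄² = χ₋₃∘Nrd`, so `Θ^{(2)}` is the
coefficientwise `χ₋₃`-twist of a `3`-depleted level-`3p` Brandt series) ARE `χ₋₃`-twists of level-`3p` cusp forms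
(row E-desc-163).  PROVED below: E-161 ∧ E-162 ∧ E-163 ⟹ the sign row 156β† `ThetaPairAtkinLehnerSignAtNinePrime`
(hence 156β⁺, 156β, and — with p3's `thetaFourOmegaIntegral_one_of_closed` — E-desc-156 at `e = 1` with NO further input);
the `e = 2` half uses only E-163 and the tree theorem `atkinLehnerInvolutionAt_nine_charTwist_three`.
Also PROVED: row E-desc-160 `AtkinLehnerSignThreeEqRootNumberThree` from the two tree NAMED FACTS
`IsNewform0.exists_atkinLehnerInvolutionAt_eq_smul` (Atkin–Lehner 1970 Thm 3) and
`WeierstrassCurve.atkinLehnerEigenvalueAt_three_eq_rootNumberThree` (Kellock–Dokchitser Rem. 2.2 at `p = 3`, p744705).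

CENSUS = BC5 WITNESSES (kit tag bsd, `HOME/desc/g23/nb/signtwist9.gp`): see MEMO-desc §48 (F1: every newform of level
`9M`, `M ≤ 113` in the theta census: `λ₉ = +1 ⟺ twist-stable`, `λ₉ = −1 ⟺ twist of new level M or 3M`; F2: theta records
of g22 in the span of the twist-stable newform orbits (e = 1) / of the twist orbits (e = 2); F3: every `e = 2` record is
the `χ₋₃`-twist of a level-`3M` cusp form, solved exactly on `mfbasis`).  BSD is not proved by this; Manin's conjecture
is not proved by this; the rows are census-backed conjectures (E-161 is a theorem in print).

TYPER NOTE (typer g21, T-desc-45).  SOURCE = HOME/desc/g23/Sketch-desc-g23.lean sha16 39bcec52585e07cf (197 l.; desc: farm rc 0·0·0·0; BC7 3/3 CLEAN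
6cecea234fa9497d; MEMO-desc §48; census nb/signtwist9.gp f440e4752d23ce36: F1 1144/1144, F2 1554/1554 + 1216/1216, F3 1680/1680, DIM 16/16 + 16/16)
VERBATIM; the only typer delta is this note.  LAYERING DECISION (desc asked «say which»): p3's `Theorems.ManinLocalTwoThreeThetaPairCuspThird` is a
Theses-FREE Theorems leaf (typer BFS of the `import Summits.…` closure: 30 modules, no `Theses.`), so it is imported AS IS — no local re-proof of
`isQuadratic_chi3`/`isPrimitive_chi3`, no split file.  Imports: landed SIBLING 4 `…ManinAdditive.ThetaFourOmegaSign` (p744564) + that leaf + Literature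
`RootNumberAtkinLehnerThree` (p744705) + `Mathlib.NumberTheory.LegendreSymbol.QuadraticChar.Basic` + HarnessLib(+Audit.Tags); namespace
`…ManinAdditive.ThetaFourOmega`.  ROWS (desc's `@[conjecture]` tags, nothing asserted): **E-desc-161 `AtkinLehnerNinePlusOfTwistStable`** (a theorem in
print: Atkin–Li 1978 §4 + ε(Ind θ₄) = +1), **E-desc-162 `ThetaPairOneMemSpanTwistStable`**, **E-desc-163 `ThetaPairTwoEqTwistOfLevelThree`**; PROVED
`chi3_neg_one`, `factorization_nine_mul_three`, `atkinLehnerInvolutionAt_eq_self_of_mem_span`, **`thetaPairAtkinLehnerSign_of_twistType`** (161 ∧ 162 ∧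
163 ⟹ 156β†), `thetaPairAtkinLehnerClosed_of_twistType`, **`thetaFourOmegaIntegral_one_of_twistType`** (E-156|ₑ₌₁ ⟸ 161 ∧ 162 ∧ 163, nothing else),
`thetaFourOmegaIntegral_of_twistType`, **`atkinLehnerSignThreeEqRootNumberThree_of_facts`** (E-desc-160 ⟸ the two tree named facts
`IsNewform0.exists_atkinLehnerInvolutionAt_eq_smul`, `WeierstrassCurve.atkinLehnerEigenvalueAt_three_eq_rootNumberThree`).  REFUTER: ref1/ref2 R-desc-39
PENDING at landing.  11 decl names fresh; cite keys present (AtkinLi1978, Pizer1980, Rizzo2003, KellockDokchitser2023, CremonaEcdata); no instances, no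
notation, no sorry.  bears_on: stmt-BirchSwinnertonDyer-22968 (C3 `ManinPrimeToThreeAtNine`).  BSD is not proved by this; C3 OPEN.
-/

namespace Summit.BirchSwinnertonDyer.Rank1Residual.ManinAdditive.ThetaFourOmega

open scoped MatrixGroups ModularForm
open CongruenceSubgroup WeierstrassCurve Literature.NumberTheory.EllipticCurves
open Literature.NumberTheory.EllipticCurves.ModularForms
open Summit.BirchSwinnertonDyer.Rank1Residual.ManinAdditive.ThetaFourBrandt
open Summit.BirchSwinnertonDyer.Rank1Residual.ManinAdditive.NeronOmegaThree
open Summit.BirchSwinnertonDyer.BirchSwinnertonDyer.Theorems.ManinLocalTwoThree.ThetaPairCuspThird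
  (isQuadratic_chi3 isPrimitive_chi3 thetaFourOmegaIntegral_one_of_closed)

/-! ### §6. Rows E-desc-161 / 162 / 163 (census-backed, `@[conjecture]`, nothing asserted) -/

/-- **Row E-desc-161 `AtkinLehnerNinePlusOfTwistStable`** (E-blind; a THEOREM IN PRINT, not yet in the tree): at a
level `N` with `9 ∥ N`, a newform `f ∈ S₂(Γ₀(N))` whose `χ₋₃`-twist `f ⊗ χ₋₃` is again a newform of level `N` satisfies
`w₉ f = +f`.  Reason: such `f` is supercuspidal at `3` of type `Ind θ₄` (the only exponent-`2` type stable under the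
ramified quadratic twist), `λ₉ = ε(½, Ind θ₄) = θ₄(3)·τ(θ₄)/3 = (−1)(−1) = +1`.  Typed in the cell's canonical twist
binders (as E-desc-54).  Census F1 (MEMO-desc §48).  Why it might fail: only if «AL eigenvalue = local ε» or the tame
Gauss-sum sign were mis-transcribed — both are re-verified numerically on every newform of the census levels.
[cite: AtkinLi1978, §4] [cite: KellockDokchitser2023, Rem. 2.2] [cite: Rizzo2003, Table II (III, III*: W₃ = +1)] -/
@[conjecture]
def AtkinLehnerNinePlusOfTwistStable : Prop :=
  ∀ (N : ℕ) [NeZero N] (h9 : 3 ^ 2 ∣ N) (χ : DirichletCharacter ℂ 3) (hχ : χ.IsQuadratic), χ.IsPrimitive →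
    N.factorization 3 = 2 →
  ∀ f : CuspForm (Gamma0 N) 2, IsNewform0 f → IsNewform0 (charTwist N dvd_rfl h9 hχ f) →
    atkinLehnerInvolutionAt N 2 3 f = f

/-- **Row E-desc-162 `ThetaPairOneMemSpanTwistStable`** (E-blind, census-backed): both members of a `θ₄`-theta pair
(`e = 1`) of the special order of level `9p` (`p ≥ 5` prime) lie in the `ℂ`-span of the `χ₋₃`-TWIST-STABLE newforms of
level `9p` (the supercuspidal-at-`3` part; Jacquet–Langlands: the `θ₄`-isotypic vectors of `O₃^× /(1+𝔓) ≅ 𝔽₉^×` generate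
the `2`-dimensional representation of `D₃^×` matching `Ind θ₄`).  Census F2 (MEMO-desc §48): every `e = 1` theta record
of g22 lies in the `ℚ`-span of the `λ₉ = +1` (= twist-stable, F1) newform orbits.  Why it might fail: a `θ₄`-pair with a
component on an old form or on a twist orbit at some level outside the census (the basis problem with character `θ₄` at
level `9p` is Pizer's Conj. 9.24 territory, not a theorem we hold).
[cite: Pizer1980, Thm. 9.1, Rem. 9.3] [cite: CremonaEcdata] -/
@[conjecture]
def ThetaPairOneMemSpanTwistStable : Prop :=
  ∀ (p : ℕ) [NeZero (9 * p)], p.Prime → 5 ≤ p →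
  ∀ (h9 : 3 ^ 2 ∣ 9 * p) (χ : DirichletCharacter ℂ 3) (hχ : χ.IsQuadratic), χ.IsPrimitive →
  ∀ (u : Fin (p + 1) → ZI) (x : Fin (p + 1)) (Θ₁ Θ₂ : CuspForm (Gamma0 (9 * p)) 2),
    IsThetaPair 1 p (9 * p) u x Θ₁ Θ₂ →
    Θ₁ ∈ Submodule.span ℂ {f : CuspForm (Gamma0 (9 * p)) 2 |
        IsNewform0 f ∧ IsNewform0 (charTwist (9 * p) dvd_rfl h9 hχ f)} ∧
      Θ₂ ∈ Submodule.span ℂ {f : CuspForm (Gamma0 (9 * p)) 2 |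
        IsNewform0 f ∧ IsNewform0 (charTwist (9 * p) dvd_rfl h9 hχ f)}

/-- **Row E-desc-163 `ThetaPairTwoEqTwistOfLevelThree`** (E-blind, census-backed): both members of a `θ₄²`-theta pair
(`e = 2`) are `χ₋₃`-twists `g ⊗ χ₋₃ = charTwist (9p) g` of cusp forms `g ∈ S₂(Γ₀(3p))`.  On coefficients this is the
tree's `(−1)^{θ̃₄(γ)} = χ₋₃(Nrd γ)` (`neg_one_pow_theta4Exp_of_mem`): `Θ^{(2)} = (3-depleted level-3p Brandt series) ⊗ χ₋₃`;
the content is that the depleted `e = 0` series comes from level `3p` (Eichler's basis theorem at square-free level).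
Census F3 (MEMO-desc §48): for every `e = 2` record the untwisted prime-to-`3` packet is solved EXACTLY on
`mfbasis S₂(Γ₀(3M))`.  Why it might fail: a `θ₄²`-vector with a component of supercuspidal type (sign `+1`) at a level
outside the census.  [cite: Pizer1980, Thm. 2.26, Thm. 9.1] [cite: CremonaEcdata] -/
@[conjecture]
def ThetaPairTwoEqTwistOfLevelThree : Prop :=
  ∀ (p : ℕ) [NeZero (p * 3)] [NeZero (9 * p)], p.Prime → 5 ≤ p →
  ∀ (hNL : p * 3 ∣ 9 * p) (h9 : 3 ^ 2 ∣ 9 * p) (χ : DirichletCharacter ℂ 3) (hχ : χ.IsQuadratic), χ.IsPrimitive →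
  ∀ (u : Fin (p + 1) → ZI) (x : Fin (p + 1)) (Θ₁ Θ₂ : CuspForm (Gamma0 (9 * p)) 2),
    IsThetaPair 2 p (9 * p) u x Θ₁ Θ₂ →
    ∃ g₁ g₂ : CuspForm (Gamma0 (p * 3)) 2,
      Θ₁ = charTwist (9 * p) hNL h9 hχ g₁ ∧ Θ₂ = charTwist (9 * p) hNL h9 hχ g₂

/-! ### §7. PROVED: E-161 ∧ E-162 ∧ E-163 ⟹ 156β† (⟹ 156β⁺ ⟹ 156β; and E-desc-156 at `e = 1`) -/

/-- `χ₋₃ = quadraticChar 𝔽₃ ⊗ ℂ` is odd: `χ₋₃(−1) = −1` (`−1` is not a square in `𝔽₃`). [folklore] -/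
theorem chi3_neg_one :
    ((quadraticChar (ZMod 3)).ringHomComp (Int.castRingHom ℂ) : DirichletCharacter ℂ 3) (-1) = -1 := by
  have h : quadraticChar (ZMod 3) (-1) = -1 := by
    rw [quadraticChar_neg_one_iff_not_isSquare, FiniteField.isSquare_neg_one_iff, ZMod.card]
    decide
  rw [MulChar.ringHomComp_apply, h]
  simp

/-- `(9p).factorization 3 = 2` for `3 ∤ p`. [folklore] -/
theorem factorization_nine_mul_three {p : ℕ} (hp : p ≠ 0) (hp3 : ¬ 3 ∣ p) : (9 * p).factorization 3 = 2 := by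
  have h9f : (9 : ℕ).factorization 3 = 2 := by
    rw [show (9 : ℕ) = 3 ^ 2 by norm_num, Nat.factorization_pow, Finsupp.smul_apply, smul_eq_mul,
      Nat.Prime.factorization_self Nat.prime_three]
  rw [Nat.factorization_mul (by norm_num) hp, Finsupp.add_apply, h9f, Nat.factorization_eq_zero_of_not_dvd hp3]

/-- PROVED (the `e = 1` mechanism): under E-161, `w₉` fixes the whole span of the twist-stable newforms. -/
theorem atkinLehnerInvolutionAt_eq_self_of_mem_span (h161 : AtkinLehnerNinePlusOfTwistStable)
    {N : ℕ} [NeZero N] (h9 : 3 ^ 2 ∣ N) {χ : DirichletCharacter ℂ 3} (hχ : χ.IsQuadratic) (hprim : χ.IsPrimitive)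
    (hfac : N.factorization 3 = 2) {Θ : CuspForm (Gamma0 N) 2}
    (hΘ : Θ ∈ Submodule.span ℂ {f : CuspForm (Gamma0 N) 2 | IsNewform0 f ∧ IsNewform0 (charTwist N dvd_rfl h9 hχ f)}) :
    atkinLehnerInvolutionAt N 2 3 Θ = Θ := by
  have hle : Submodule.span ℂ {f : CuspForm (Gamma0 N) 2 | IsNewform0 f ∧ IsNewform0 (charTwist N dvd_rfl h9 hχ f)} ≤
      LinearMap.ker (atkinLehnerInvolutionAt N 2 3 - LinearMap.id) := by
    rw [Submodule.span_le]
    rintro f ⟨hf, hft⟩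
    simp only [SetLike.mem_coe, LinearMap.mem_ker, LinearMap.sub_apply, LinearMap.id_apply, sub_eq_zero]
    exact h161 N h9 χ hχ hprim hfac f hf hft
  have := hle hΘ
  simpa [sub_eq_zero] using this

/-- **PROVED: E-161 ∧ E-162 ∧ E-163 ⟹ 156β† `ThetaPairAtkinLehnerSignAtNinePrime`** (`e = 1`: span of twist-stable
newforms, each fixed by `w₉`; `e = 2`: a `χ₋₃`-twist from level `3p`, on which `w₉ = χ₋₃(−1) = −1` by the tree theorem
`atkinLehnerInvolutionAt_nine_charTwist_three`). -/
theorem thetaPairAtkinLehnerSign_of_twistType (h161 : AtkinLehnerNinePlusOfTwistStable)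
    (h162 : ThetaPairOneMemSpanTwistStable) (h163 : ThetaPairTwoEqTwistOfLevelThree) :
    ThetaPairAtkinLehnerSignAtNinePrime := by
  intro p e _ hp h5 he u x Θ₁ Θ₂ hΘ
  have hp3 : ¬ 3 ∣ p := fun h => by
    have := (Nat.prime_dvd_prime_iff_eq Nat.prime_three hp).mp h; omega
  have h9 : 3 ^ 2 ∣ 9 * p := ⟨p, by norm_num⟩
  rcases he with rfl | rfl
  · obtain ⟨h₁, h₂⟩ := h162 p hp h5 h9 _ isQuadratic_chi3 isPrimitive_chi3 u x Θ₁ Θ₂ hΘ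
    have hfac := factorization_nine_mul_three hp.ne_zero hp3
    have e1 : ((-1 : ℤ) ^ (1 + 1)) = 1 := by norm_num
    rw [e1, one_zsmul, one_zsmul]
    exact ⟨atkinLehnerInvolutionAt_eq_self_of_mem_span h161 h9 isQuadratic_chi3 isPrimitive_chi3 hfac h₁,
      atkinLehnerInvolutionAt_eq_self_of_mem_span h161 h9 isQuadratic_chi3 isPrimitive_chi3 hfac h₂⟩
  · haveI : NeZero p := ⟨hp.ne_zero⟩
    haveI : NeZero (p * 3) := ⟨Nat.mul_ne_zero hp.ne_zero (by norm_num)⟩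
    have hNL : p * 3 ∣ 9 * p := ⟨3, by ring⟩
    obtain ⟨g₁, g₂, rfl, rfl⟩ := h163 p hp h5 hNL h9 _ isQuadratic_chi3 isPrimitive_chi3 u x Θ₁ Θ₂ hΘ
    have e3 : ((-1 : ℤ) ^ (2 + 1)) = -1 := by norm_num
    rw [e3, neg_one_zsmul, neg_one_zsmul]
    exact ⟨atkinLehnerInvolutionAt_nine_charTwist_three hp3 dvd_rfl hNL h9 isQuadratic_chi3 chi3_neg_one g₁,
      atkinLehnerInvolutionAt_nine_charTwist_three hp3 dvd_rfl hNL h9 isQuadratic_chi3 chi3_neg_one g₂⟩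

/-- PROVED: E-161 ∧ E-162 ∧ E-163 ⟹ 156β⁺ `ThetaPairAtkinLehnerClosedAtNinePrime` (ref1 (b4)'s single open input). -/
theorem thetaPairAtkinLehnerClosed_of_twistType (h161 : AtkinLehnerNinePlusOfTwistStable)
    (h162 : ThetaPairOneMemSpanTwistStable) (h163 : ThetaPairTwoEqTwistOfLevelThree) :
    ThetaPairAtkinLehnerClosedAtNinePrime :=
  thetaPairAtkinLehnerClosed_of_sign (thetaPairAtkinLehnerSign_of_twistType h161 h162 h163)

/-- PROVED: **E-desc-156 at `e = 1` ⟸ E-161 ∧ E-162 ∧ E-163** and NOTHING ELSE (p3's kernel theorem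
`thetaFourOmegaIntegral_one_of_closed` discharges the cusp `1/3`): the `θ₄`-theta pairs lie in `Ω₃(9p)`. -/
theorem thetaFourOmegaIntegral_one_of_twistType (h161 : AtkinLehnerNinePlusOfTwistStable)
    (h162 : ThetaPairOneMemSpanTwistStable) (h163 : ThetaPairTwoEqTwistOfLevelThree)
    (p : ℕ) [NeZero (9 * p)] (hp : p.Prime) (h5 : 5 ≤ p) (u : Fin (p + 1) → ZI) (x : Fin (p + 1))
    (Θ₁ Θ₂ : CuspForm (Gamma0 (9 * p)) 2) (h : IsThetaPair 1 p (9 * p) u x Θ₁ Θ₂) :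
    Θ₁ ∈ omegaLatticeAtThree (9 * p) ∧ Θ₂ ∈ omegaLatticeAtThree (9 * p) :=
  thetaFourOmegaIntegral_one_of_closed (thetaPairAtkinLehnerClosed_of_twistType h161 h162 h163) p hp h5 u x Θ₁ Θ₂ h

/-- PROVED: E-desc-156 (both `e`) ⟸ E-161 ∧ E-162 ∧ E-163 ∧ 156γ. -/
theorem thetaFourOmegaIntegral_of_twistType (h161 : AtkinLehnerNinePlusOfTwistStable)
    (h162 : ThetaPairOneMemSpanTwistStable) (h163 : ThetaPairTwoEqTwistOfLevelThree)
    (hγ : ThetaPairCuspThirdPiIntegralAtNinePrime) : ThetaFourOmegaIntegralAtNinePrime :=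
  thetaFourOmegaIntegral_of_sign (thetaPairAtkinLehnerSign_of_twistType h161 h162 h163) hγ

/-! ### §8. PROVED: row E-desc-160 from the tree's two NAMED FACTS -/

/-- **PROVED: E-desc-160 `AtkinLehnerSignThreeEqRootNumberThree` ⟸ (Atkin–Lehner 1970, Thm. 3: newforms are
`w_{Q_p}`-eigen with eigenvalue `±1`) ∧ (Kellock–Dokchitser 2023, Rem. 2.2 at `p = 3`: that eigenvalue is Rizzo's `W₃`)**,
both tree NAMED FACTS (`IsNewform0.exists_atkinLehnerInvolutionAt_eq_smul`,
`WeierstrassCurve.atkinLehnerEigenvalueAt_three_eq_rootNumberThree`, p744705), used as hypotheses BY NAME. -/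
theorem atkinLehnerSignThreeEqRootNumberThree_of_facts
    (hAL : ∀ (N : ℕ) [NeZero N], IsNewform0.exists_atkinLehnerInvolutionAt_eq_smul (N := N) (k := 2))
    (hKD : ∀ W : WeierstrassCurve ℚ, W.atkinLehnerEigenvalueAt_three_eq_rootNumberThree) :
    AtkinLehnerSignThreeEqRootNumberThree := by
  intro W _ _ f hf h3
  obtain ⟨ε, _, hw⟩ := hAL (W.conductorNorm ℤ) hf.1 Nat.prime_three h3
  have hε : atkinLehnerEigenvalueAt f 3 = ε := atkinLehnerEigenvalueAt_eq_of_eq_smul (IsNewform0.ne_zero hf.1) hw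
  have hK : atkinLehnerEigenvalueAt f 3 = (W.rootNumberThree : ℂ) := hKD W hf h3
  rw [hw, ← hε, hK]

end Summit.BirchSwinnertonDyer.Rank1Residual.ManinAdditive.ThetaFourOmega
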